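import Mathlib
import Summits.Ventures.HodgeRepro2.Tier7.Line3.AdicCompletionRestrictionDegree

/-!
# Tier7/Line3/SplitPlaceDegree — «two primes above `v` in a quadratic extension» gives `e = f = 1` at each
(seat t7-x1, gen 5; the split-place local-degree datum of AdicCompletionSplit p715395 in the SAME arithmetic form as the
non-split datum of p706703 / p716023)

LINE 3 (t7-plan-3), version (ii). The κ-side package on Mathlib's completions displays, at the non-split places, «one
prime above `w`» (`hone : ncard (primesOver …) = 1`) and, at the split places, the local-degree datum
`hsplit : localDeg (maximalIdeal w) (wE w) = 1` («`wE w` is one of the two primes above `w`, `e = f = 1`»). This module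
derives the latter from «TWO primes above `v`» and `[E : K] = 2`:

* `sum_primesOver_eq_card_of_le_one`-style bookkeeping: if a sum of `card s` natural terms each `≥ 1` equals `card s`,
  every term is `1` (`Finset.sum_eq_sum_iff_of_le`);
* `ramificationIdx'_mul_inertiaDeg'_eq_one_of_ncard_eq_two`: with `ncard (primesOver v.asIdeal (𝓞 E)) = 2` and
  `finrank K E = 2`, `e(P) · f(P) = 1` for every prime `P` above `v` (`Ideal.sum_ramification_inertia`);
* `localDeg_eq_one_of_ncard_eq_two : localDeg v wE = 1` for every `wE` above `v`, and the two pieces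
  `ramificationIdx'_eq_one_of_ncard_eq_two`, `inertiaDeg_eq_one_of_ncard_eq_two`;
* `hsplit_of_ncard_eq_two`: AdicCompletionSplit's displayed `hsplit` from «`∀ w ∈ Sp, ncard (primesOver …) = 2`».

WHAT THIS CHANGES IN THE [W] COLUMN: the split-place datum is now stated in the same vocabulary as the non-split one —
the NUMBER of primes above the place (`2` resp. `1`) and the degree `[E : K] = 2`; «`wE w` is one of the two primes
above `w`» is then a theorem for ANY choice of `wE w` above a split `w`. CAUTION (crit-2 STATUS l. 16300 (4)): the
non-split datum `hone` («one prime above `w`») with `[E : K] = 2` gives `e f = 2` — INERT (`f = 2`) OR RAMIFIED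
(`e = 2`); it does NOT distinguish the two, so the dictionary word «inert» for `w ∉ Sp` is a [W] sentence about the real
`w`, not a consequence of `hone`; no clause of the κ-side chain reads `f = 2` (the level base is read from the
completion itself, `AdicCompletionLevel.q (wE v₁)`; the `b`-side's `e = 1` is InertLevelBase's own displayed datum) —
a later row needing `f = 2` at `w ∉ Sp` displays it (`inertiaDeg = 2`, or `ramificationIdx' = 1`), it is not free.
STILL IN WORDS: that the real `w` splits (two primes above it), the identification (a′). Nothing here is about (N), (P), the real `X`, or HC_CM; §8(d): NO. Blind
lane: Mathlib + the HodgeRepro2 prefix; no sorry; axioms ⊆ {propext, Classical.choice, Quot.sound}.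
-/

namespace Summit.Ventures.HodgeRepro2.Tier7.Line3.SplitPlaceDegree

open IsDedekindDomain IsDedekindDomain.HeightOneSpectrum NumberField
  Summit.Ventures.HodgeRepro2.Tier7.Line3.AdicCompletionRestriction
open scoped NumberField

/-- a sum of `card s` natural terms each `≥ 1` equal to `card s` forces every term to be `1`. -/
theorem eq_one_of_sum_eq_card {ι : Type*} (s : Finset ι) (g : ι → ℕ) (h1 : ∀ i ∈ s, 1 ≤ g i)
    (hsum : ∑ i ∈ s, g i = s.card) : ∀ i ∈ s, g i = 1 := by
  have h : (∑ i ∈ s, (1 : ℕ)) = ∑ i ∈ s, g i := by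
    rw [Finset.sum_const, smul_eq_mul, mul_one, hsum]
  exact fun i hi => ((Finset.sum_eq_sum_iff_of_le h1).1 h i hi).symm

variable {K E : Type*} [Field K] [NumberField K] [Field E] [NumberField E] [Algebra K E]
  (v : HeightOneSpectrum (𝓞 K))

/-- `e(P) · f'(P) ≥ 1` for every prime `P` of `E` above `v` — `ramificationIdx' ≠ 0` consumes `v.ne_bot` and the
`LiesOver` / `IsPrime` of `P ∈ primesOver` (Mathlib's `ramificationIdx'_ne_zero_of_liesOver`), `inertiaDeg_pos`
consumes `P` prime and `Module.Finite (𝓞 K) (𝓞 E)`, and `inertiaDeg'_eq_inertiaDeg` consumes `v.asIdeal.IsMaximal`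
(`HeightOneSpectrum.isMaximal`) and `P` maximal (`IsMaximal.of_liesOver_isMaximal`) — the instances p707547 already
used, nothing new (crit-2 STATUS l. 16300 (2)). -/
theorem one_le_ramificationIdx'_mul_inertiaDeg' (P : Ideal (𝓞 E)) (hP : P ∈ Ideal.primesOver v.asIdeal (𝓞 E)) :
    1 ≤ v.asIdeal.ramificationIdx' P * v.asIdeal.inertiaDeg' P := by
  haveI := hP.1
  haveI := hP.2
  haveI : P.IsMaximal := Ideal.IsMaximal.of_liesOver_isMaximal (p := v.asIdeal) P
  rw [Ideal.inertiaDeg'_eq_inertiaDeg]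
  exact Nat.one_le_iff_ne_zero.2 (mul_ne_zero
    (Ideal.IsDedekindDomain.ramificationIdx'_ne_zero_of_liesOver P v.ne_bot)
    (Ideal.inertiaDeg_pos P (𝓞 K)).ne')

/-- **two primes above `v` in a quadratic extension ⇒ `e(P) · f(P) = 1` at each** (`Ideal.sum_ramification_inertia`). -/
theorem ramificationIdx'_mul_inertiaDeg'_eq_one_of_ncard_eq_two
    (h2 : (Ideal.primesOver v.asIdeal (𝓞 E)).ncard = 2) (hdeg : Module.finrank K E = 2)
    (P : Ideal (𝓞 E)) (hP : P ∈ Ideal.primesOver v.asIdeal (𝓞 E)) :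
    v.asIdeal.ramificationIdx' P * v.asIdeal.inertiaDeg' P = 1 := by
  have hsum := Ideal.sum_ramification_inertia (𝓞 E) K E (p := v.asIdeal) v.ne_bot
  have hcard : (IsDedekindDomain.primesOverFinset v.asIdeal (𝓞 E)).card = 2 := by
    rw [← Set.ncard_coe_finset, IsDedekindDomain.coe_primesOverFinset v.ne_bot, h2]
  have hP' : P ∈ IsDedekindDomain.primesOverFinset v.asIdeal (𝓞 E) := by
    rw [← Finset.mem_coe, IsDedekindDomain.coe_primesOverFinset v.ne_bot]
    exact hP
  refine eq_one_of_sum_eq_card _ _ (fun Q hQ => one_le_ramificationIdx'_mul_inertiaDeg' v Q ?_) (by rw [hsum, hdeg, hcard]) P hP'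
  rw [← Finset.mem_coe, IsDedekindDomain.coe_primesOverFinset v.ne_bot] at hQ
  exact hQ

variable (wE : HeightOneSpectrum (𝓞 E)) [wE.asIdeal.LiesOver v.asIdeal]

/-- **`e = 1` at a chosen prime above a split `v`** (two primes above, `[E : K] = 2`). -/
theorem ramificationIdx'_eq_one_of_ncard_eq_two (h2 : (Ideal.primesOver v.asIdeal (𝓞 E)).ncard = 2)
    (hdeg : Module.finrank K E = 2) : v.asIdeal.ramificationIdx' wE.asIdeal = 1 :=
  Nat.eq_one_of_mul_eq_one_right (ramificationIdx'_mul_inertiaDeg'_eq_one_of_ncard_eq_two v h2 hdeg wE.asIdeal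
    (asIdeal_mem_primesOver v wE))

/-- **`f = 1` at a chosen prime above a split `v`**. -/
theorem inertiaDeg_eq_one_of_ncard_eq_two (h2 : (Ideal.primesOver v.asIdeal (𝓞 E)).ncard = 2)
    (hdeg : Module.finrank K E = 2) : wE.asIdeal.inertiaDeg (𝓞 K) = 1 := by
  have h := ramificationIdx'_mul_inertiaDeg'_eq_one_of_ncard_eq_two v h2 hdeg wE.asIdeal (asIdeal_mem_primesOver v wE)
  rw [Ideal.inertiaDeg'_eq_inertiaDeg] at h
  exact Nat.eq_one_of_mul_eq_one_left h

/-- **the local degree is `1` at a chosen prime above a split `v`**: AdicCompletionSplit's displayed datum `hsplit`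
from «two primes above `v`» and `[E : K] = 2`. -/
theorem localDeg_eq_one_of_ncard_eq_two (h2 : (Ideal.primesOver v.asIdeal (𝓞 E)).ncard = 2)
    (hdeg : Module.finrank K E = 2) : localDeg v wE = 1 := by
  rw [localDeg, ramificationIdx'_eq_one_of_ncard_eq_two v wE h2 hdeg, inertiaDeg_eq_one_of_ncard_eq_two v wE h2 hdeg]

/-- **AdicCompletionSplit's displayed `hsplit` from «two primes above each split place»** (p715395's
`SplitLocal.ofAdicCompletion` / p716023's package consume it by name). -/
theorem hsplit_of_ncard_eq_two (wE' : FinitePlace K → HeightOneSpectrum (𝓞 E))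
    (hlies : ∀ w, (wE' w).asIdeal.LiesOver (FinitePlace.maximalIdeal w).asIdeal) (Sp : Set (FinitePlace K))
    (h2 : ∀ w ∈ Sp, (Ideal.primesOver (FinitePlace.maximalIdeal w).asIdeal (𝓞 E)).ncard = 2)
    (hdeg : Module.finrank K E = 2) :
    ∀ w ∈ Sp, localDeg (FinitePlace.maximalIdeal w) (wE' w) = 1 := fun w hw =>
  haveI := hlies w
  localDeg_eq_one_of_ncard_eq_two (FinitePlace.maximalIdeal w) (wE' w) (h2 w hw) hdeg

end Summit.Ventures.HodgeRepro2.Tier7.Line3.SplitPlaceDegree
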